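import Literature.Geometry.Lorentzian.SchwarzschildKerrSchildRicciFlat
import HarnessLib

/-!
# Stub `stub_ricciFlatKS` of the line `plug-the-second-sheet`: the Schwarzschild metric in
# ingoing Kerr–Schild Cartesian coordinates is Ricci-flat

For every real `M` and `r₀`, the smooth Kerr–Schild metric `Kerr.smoothMetric M 0 r₀`
(`g = η + (2M/r) ℓ ⊗ ℓ`, `ℓ = (1, x⃗/r)`, `r = ‖x⃗‖`) on the chart domain
`Kerr.region 0 r₀ = {r > max r₀ 0} ⊆ E4` has vanishing Ricci tensor, `Ric_x = 0` at every point
(Schwarzschild 1916; Kerr–Schild 1965, §3; O'Neill 1995, Ch. 2, Thm. 2.6.1). This is the input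
`hRic` of the Gauss–Codazzi constraint identities for the slices of the line, and it is exactly
the tree's `Kerr.ricci_smoothMetric_zero_spin` (`SchwarzschildKerrSchildRicciFlat.lean`, the
proved `a = 0` case of the named fact `Kerr.isRicciFlat`), which this file re-exports under the
registered stub name.

## References

* R. P. Kerr, A. Schild, *A new class of vacuum solutions of the Einstein field equations*
  (1965), §3.
* B. O'Neill, *The geometry of Kerr black holes* (1995), Ch. 2, Thm. 2.6.1.
-/

noncomputable section

set_option linter.dupNamespace false

open Literature.Geometry.Lorentzian
open scoped Manifold ContDiff Topology

namespace Summit.FinalStateConjecture.FinalStateConjecture.Theorems.SwallowTheDatum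

/-- **Stub `stub_ricciFlatKS`: the Schwarzschild metric in ingoing Kerr–Schild Cartesian
coordinates is Ricci-flat.** For all real `M`, `r₀` (no sign condition on `M`) the smooth
Kerr–Schild metric `Kerr.smoothMetric M 0 r₀ = η + (2M/r) ℓ ⊗ ℓ`, `ℓ = (1, x⃗/r)`, on
`Kerr.region 0 r₀ = {‖x⃗‖ > max r₀ 0}` satisfies `Ric_x = 0` at every point: the `a = 0` case of
the named fact `Kerr.isRicciFlat` for the `C^∞` copy of the metric, proved in the tree as
`Kerr.ricci_smoothMetric_zero_spin` (Schwarzschild 1916; Kerr–Schild 1965, §3; O'Neill 1995,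
Ch. 2, Thm. 2.6.1). [cite: KerrSchild1965, §3] -/
theorem stub_ricciFlatKS :
    ∀ [Kerr.Facts] (M r₀ : ℝ) [(Kerr.smoothMetric M 0 r₀).HasLeviCivita] (x : Kerr.region 0 r₀),
      (Kerr.smoothMetric M 0 r₀).ricci x = 0 :=
  fun M r₀ _ x ↦ Kerr.ricci_smoothMetric_zero_spin M r₀ x

end Summit.FinalStateConjecture.FinalStateConjecture.Theorems.SwallowTheDatum

end
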